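import Summits.QuantumFields.YangMills.Theorems.LuscherReductionTraceDoorBasics
import Summits.QuantumFields.YangMills.Theorems.LuscherReductionTraceDoorEnclosure
import Summits.QuantumFields.YangMills.Theorems.LuscherReductionTraceDoorKT
import Summits.QuantumFields.YangMills.Theorems.LuscherReductionRunningReductionOneSiteTailClosed
import Summits.QuantumFields.YangMills.Theorems.LuscherReductionRunningReductionOneSiteTailGlue
import Summits.QuantumFields.YangMills.Theorems.LuscherReductionTraceFormulaClosed
import Summits.QuantumFields.YangMills.Theorems.LuscherReductionRunningReductionKTDoorR3
import Summits.QuantumFields.YangMills.Theorems.LuscherReductionRunningReductionKTRCalibration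
import Summits.QuantumFields.YangMills.Theorems.FemtoTransferGapBounds
import Summits.QuantumFields.YangMills.Theorems.LuscherReductionTraceDoorCorollary
import Summits.QuantumFields.YangMills.Theorems.LuscherReductionTraceDoorOST
import HarnessLib

/-!
# Crux RED `RunningReduction` (stmt-QuantumFields-19978), child `TwistedTraceScaling` (stmt-QuantumFields-20203): the UPPER-HALF TT DOOR —
# BASICS: elementary facts, femto-time grid arithmetic, the pure-real ratio rule, and the dressed-Ritz LOWER JAW

Support module of the `FemtoTransferGap` group (fleet service by seat ym-infvol-p2 g7; route `LuscherReduction`, owner ym-beyond-p1, femto rung R2b1).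
RE-HOMES VERBATIM §1b, the §4 window lemma `oneSiteCoupling_ge_of_small` and the §6 pure-real helpers of the planner's kernel-checked crux workfile
`Summits/QuantumFields/YangMills/Cruxes/RunningReduction/Lines/upper_trace_door.lean` rev 3 (commit efcd23ff80e7, sha16 fb9acfdf08f96b2f; seat
ym-cruxidea-19978-1 GEN 7–8; memo `…/Lines/upper_trace_door.md` rev 4) — Cruxes modules are not importable on the farm — under the Theorems-side namespace
`Summit.QuantumFields.YangMills.Theorems.FemtoTransferGap.UTD` (credit: every proof below is the planner's, moved character for character unless marked NEW).

NEW here (factored out of the workfile's §2 and §6, where the same ≈ 50-line block appears twice): `lowerJaw` — at one `(L, β)`, the level-`k` data of the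
sibling child `DressedRitz` (a physical `l2`-orthonormal `qform`-diagonal family with Ritz ratios in two-sided Lüscher position `e^{±Cλ²/L}` against the
one-site ratios, plus coarse top capture at precision `η`), fed through the tree's Rayleigh–Ritz ≤ min–max inequality `KTDoorR3.ritzBasicsR3` and the top
capture `levelValue_zero_le_of_forall_rayleigh_le`, gives the LOWER JAW `e^{−(C⁺λ+η)λ/L}·(μ_j/μ_0) ≤ λ_j/λ_0` for every `j ≤ k` (`C⁺ = max C 0` or any
`C1 ≥ C`).  The sandwich (`…UpperTraceDoorSandwich`) and the converse door (`…UpperTraceDoorConverse`) both call it.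

Contents: `hasSum_xval_pow` (currency bridge from the CLOSED child `TraceFormula`: `Σ_j (λ_j/λ_0)^T = Z_phys(T)/λ_0^T`),
`xval_nonneg/le_one/le_xval` (for `β ≥ 1`), `femtoSteps_mul_bounds/mono/two_mul_le`, `two_mul_femtoSteps_le` (`T ≤ ⌈2sL/λ⌉ ≤ 2T ≤ ⌈2sL/λ⌉+1`),
`oneSiteUpper_single` (ONE's coarse upper law at one level, from the closed crux `OneSiteLevels`), `oneSiteCoupling_ge_of_small`,
(the workfile's `one_sub_exp_neg_le` ∕ `tsum_shift_le` are NOT re-homed: the tree already has `Real.add_one_le_exp` ∕ `TraceDoor.OST.tsum_shift_le`),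
`pow_le_pow_add_one_sub` (one-step robustness of Laplace weights), `ratio_rule` (`|b/a² − b₁/a₁²| ≤ |b−b₁| + 2|a−a₁|`), `lowerJaw` (NEW).

HONEST FRAMING: fixed-window bookkeeping on the femto rung R2b1 (`FemtoGapOfRecord`); nothing here bears on infinite volume, the continuum limit in
large volume, or the Clay mass gap.  References: M. Lüscher, NPB 219 (1983) 233 [cite: Luscher1983, §3]; Reed–Simon IV [cite: ReedSimonIV1978, Thm. XIII.1].
-/

set_option autoImplicit false

noncomputable section

open MeasureTheory Filter Topology Real
open Literature.MathematicalPhysics.QuantumFieldTheory hiding SU2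
open Literature.MathematicalPhysics.QuantumLattice
open Literature.Analysis.OperatorTheory.YMMatrixModel
open scoped BigOperators

namespace Summit.QuantumFields.YangMills.Theorems.FemtoTransferGap.UTD

open Summit.QuantumFields.YangMills.Theorems.FemtoTransferGap
open Summit.QuantumFields.YangMills.Theorems.FemtoTransferGap.TT (physTrace)
open Summit.QuantumFields.YangMills.Theorems.FemtoTransferGap.TraceDoor
open Summit.QuantumFields.YangMills.Theorems.FemtoTransferGap.KTRCalibration (levelValue_antitone)

/-! ## §1 Elementary facts (workfile §1b, VERBATIM) -/

/-- Currency bridge (from the CLOSED child `TraceFormula`): `Σ_j (λ_j/λ_0)^T = Z_phys(T)/λ_0^T` for `β ≥ 1`, `T ≥ 2`. -/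
theorem hasSum_xval_pow {L : ℕ} [NeZero L] {β : ℝ} (hβ : 1 ≤ β) {T : ℕ} (hT : 2 ≤ T) :
    HasSum (fun j => xval L β j ^ T) (physTrace L β T / levelValue su2Rep L β 0 ^ T) := by
  have h := (TT.traceFormula_proof L β T hβ hT).div_const (levelValue su2Rep L β 0 ^ T)
  refine h.congr_fun ?_
  intro j
  unfold xval; rw [div_pow]

/-- `0 ≤ x_j = λ_j/λ_0` (`β ≥ 1`). -/
theorem xval_nonneg {L : ℕ} [NeZero L] {β : ℝ} (hβ : 1 ≤ β) (j : ℕ) : 0 ≤ xval L β j :=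
  div_nonneg (transferValuesNonneg L β j hβ) (levelValue_zero_su2Rep_pos L β).le

/-- `x_j ≤ 1` (`β ≥ 1`; `levelValue_antitone`). -/
theorem xval_le_one {L : ℕ} [NeZero L] {β : ℝ} (hβ : 1 ≤ β) (j : ℕ) : xval L β j ≤ 1 := by
  unfold xval
  rw [div_le_one (levelValue_zero_su2Rep_pos L β)]
  exact levelValue_antitone (zero_le_one.trans hβ) (Nat.zero_le j)

/-- `x_j ≤ x_i` for `i ≤ j` (`β ≥ 1`). -/
theorem xval_le_xval {L : ℕ} [NeZero L] {β : ℝ} (hβ : 1 ≤ β) {i j : ℕ} (hij : i ≤ j) : xval L β j ≤ xval L β i := by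
  unfold xval
  exact div_le_div_of_nonneg_right (levelValue_antitone (zero_le_one.trans hβ) hij) (levelValue_zero_su2Rep_pos L β).le

/-- `s ≤ T·(λ/L) ≤ s + λ/L` at `T = femtoSteps s β L` (`s ≥ 0`, `λ > 0`). -/
theorem femtoSteps_mul_bounds {s β : ℝ} {L : ℕ} [NeZero L] (hs : 0 ≤ s) (hl : 0 < luscherLambda β L) :
    s ≤ (femtoSteps s β L : ℝ) * (luscherLambda β L / L) ∧
      (femtoSteps s β L : ℝ) * (luscherLambda β L / L) ≤ s + luscherLambda β L / L := by
  have hL0 : (0 : ℝ) < (L : ℝ) := by exact_mod_cast Nat.pos_of_ne_zero (NeZero.ne L)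
  have hu : 0 < luscherLambda β L / L := div_pos hl hL0
  have hx : 0 ≤ s * L / luscherLambda β L := by positivity
  have hc1 : s * L / luscherLambda β L ≤ (femtoSteps s β L : ℝ) := Nat.le_ceil _
  have hc2 : (femtoSteps s β L : ℝ) < s * L / luscherLambda β L + 1 := Nat.ceil_lt_add_one hx
  have e1 : s * L / luscherLambda β L * (luscherLambda β L / L) = s := by field_simp
  constructor
  · calc s = s * L / luscherLambda β L * (luscherLambda β L / L) := e1.symm
      _ ≤ (femtoSteps s β L : ℝ) * (luscherLambda β L / L) := mul_le_mul_of_nonneg_right hc1 hu.le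
  · have : (femtoSteps s β L : ℝ) * (luscherLambda β L / L) ≤ (s * L / luscherLambda β L + 1) * (luscherLambda β L / L) :=
      mul_le_mul_of_nonneg_right hc2.le hu.le
    have e2 : (s * L / luscherLambda β L + 1) * (luscherLambda β L / L) = s + luscherLambda β L / L := by rw [add_mul, e1, one_mul]
    linarith

/-- `femtoSteps` is monotone in the femto-time. -/
theorem femtoSteps_mono {s s' β : ℝ} {L : ℕ} (h : s ≤ s') (hl : 0 ≤ luscherLambda β L) : femtoSteps s β L ≤ femtoSteps s' β L := by
  unfold femtoSteps
  apply Nat.ceil_mono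
  exact div_le_div_of_nonneg_right (mul_le_mul_of_nonneg_right h (Nat.cast_nonneg L)) hl

/-- One-site COARSE UPPER law at a single level from the closed crux ONE: `μ_j ≤ e^{−(Δ_j−ε)λ_b} μ_0` for `B ≥ B0(j,ε)`. -/
theorem oneSiteUpper_single (j : ℕ) {ε : ℝ} (hε : 0 < ε) : ∃ B0 : ℝ, ∀ B : ℝ, B0 ≤ B →
    0 < levelValue su2Rep 1 B 0 ∧ levelValue su2Rep 1 B j ≤ Real.exp (-((levelGap j - ε) * bareLambda B)) * levelValue su2Rep 1 B 0 := by
  obtain ⟨C, B0, hB⟩ := Summit.QuantumFields.YangMills.Theorems.FemtoTransferGap.oneSiteLevels_proof j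
  have hC'pos : 0 < max C 1 := lt_of_lt_of_le one_pos (le_max_right _ _)
  have htpos : 0 < ε / max C 1 := div_pos hε hC'pos
  refine ⟨max B0 (max (2 / (ε / max C 1) ^ 3) 1), fun B hBge => ?_⟩
  have hB0 : B0 ≤ B := (le_max_left _ _).trans hBge
  have hBt : 2 / (ε / max C 1) ^ 3 ≤ B := ((le_max_left _ _).trans (le_max_right _ _)).trans hBge
  have hB1 : 1 ≤ B := ((le_max_right _ _).trans (le_max_right _ _)).trans hBge
  have hBpos : 0 < B := one_pos.trans_le hB1
  obtain ⟨hpos, hup, _⟩ := hB B hB0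
  refine ⟨hpos, ?_⟩
  have hlam : bareLambda B ≤ ε / max C 1 := bareLambda_le_of_le htpos hBt
  have hlam0 : 0 < bareLambda B := bareLambda_pos' hBpos
  have hCl : C * bareLambda B ^ 2 ≤ ε * bareLambda B := by
    have h1 : C * bareLambda B ^ 2 ≤ max C 1 * bareLambda B ^ 2 :=
      mul_le_mul_of_nonneg_right (le_max_left _ _) (sq_nonneg _)
    have h2 : max C 1 * bareLambda B ≤ ε := by
      have h3 := mul_le_mul_of_nonneg_left hlam hC'pos.le
      have e : max C 1 * (ε / max C 1) = ε := by field_simp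
      linarith
    have h3 : max C 1 * bareLambda B ^ 2 ≤ ε * bareLambda B := by
      have h4 := mul_le_mul_of_nonneg_right h2 hlam0.le
      rw [sq, ← mul_assoc]; exact h4
    linarith
  calc levelValue su2Rep 1 B j ≤ Real.exp (-(levelGap j * bareLambda B - C * bareLambda B ^ 2)) * levelValue su2Rep 1 B 0 := hup
    _ ≤ Real.exp (-((levelGap j - ε) * bareLambda B)) * levelValue su2Rep 1 B 0 := by
        apply mul_le_mul_of_nonneg_right _ hpos.le
        apply Real.exp_le_exp.mpr
        nlinarith only [hCl]

/-! ## §2 The window puts the one-site coupling beyond every threshold (workfile §4, VERBATIM) -/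

/-- In the window, `lam ≤ 1/8` and `lam ≤ 1/(4B*)` put the one-site coupling beyond the threshold `B*`. -/
theorem oneSiteCoupling_ge_of_small {lam β Bs : ℝ} {L : ℕ} [NeZero L] (hlam : 0 < lam) (hW : InFemtoWindow lam β L)
    (hBs : 0 < Bs) (hlam8 : lam ≤ 1 / 8) (hlamB : lam ≤ 1 / (4 * Bs)) : Bs ≤ oneSiteCoupling β L := by
  have hB14 : 1 / (4 * lam ^ 3) ≤ oneSiteCoupling β L := oneSiteCoupling_ge_of_window hlam hW
  have hlam1 : lam ≤ 1 := by linarith only [hlam8]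
  have h3 : lam ^ 3 ≤ lam := by
    have := pow_le_pow_of_le_one hlam.le hlam1 (show 1 ≤ 3 by norm_num)
    rwa [pow_one] at this
  have h4 : lam * (4 * Bs) ≤ 1 := by rwa [le_div_iff₀ (by positivity)] at hlamB
  have h5 : Bs ≤ 1 / (4 * lam ^ 3) := by
    rw [le_div_iff₀ (by positivity)]
    calc Bs * (4 * lam ^ 3) = (4 * Bs) * lam ^ 3 := by ring
      _ ≤ (4 * Bs) * lam := mul_le_mul_of_nonneg_left h3 (by positivity)
      _ = lam * (4 * Bs) := by ring
      _ ≤ 1 := h4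
  exact h5.trans hB14

/-! ## §3 Grid arithmetic and the pure-real ratio rule (workfile §6, VERBATIM) -/

/-- `y^m ≤ y^n + (1 − y)` for `0 ≤ y ≤ 1` and `n ≤ m + 1` (one-step robustness of Laplace weights). -/
theorem pow_le_pow_add_one_sub {y : ℝ} (h0 : 0 ≤ y) (h1 : y ≤ 1) {m n : ℕ} (hnm : n ≤ m + 1) : y ^ m ≤ y ^ n + (1 - y) := by
  have ha : y ^ (m + 1) ≤ y ^ n := pow_le_pow_of_le_one h0 h1 hnm
  have hb : y ^ m ≤ 1 := pow_le_one₀ h0 h1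
  have hc : y ^ m * (1 - y) ≤ 1 * (1 - y) := mul_le_mul_of_nonneg_right hb (sub_nonneg.2 h1)
  have e : y ^ m = y ^ (m + 1) + y ^ m * (1 - y) := by ring
  linarith

/-- `⌈2sL/λ⌉ ≤ 2⌈sL/λ⌉`. -/
theorem femtoSteps_two_mul_le (s β : ℝ) (L : ℕ) : femtoSteps (2 * s) β L ≤ 2 * femtoSteps s β L := by
  unfold femtoSteps
  refine Nat.ceil_le.mpr ?_
  push_cast
  have h := Nat.le_ceil (s * (L : ℝ) / luscherLambda β L)
  have e : 2 * s * (L : ℝ) / luscherLambda β L = 2 * (s * (L : ℝ) / luscherLambda β L) := by ring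
  rw [e]; linarith

/-- `2⌈sL/λ⌉ ≤ ⌈2sL/λ⌉ + 1` (`s ≥ 0`, `λ > 0`). -/
theorem two_mul_femtoSteps_le {s β : ℝ} {L : ℕ} (hs : 0 ≤ s) (hl : 0 < luscherLambda β L) :
    2 * femtoSteps s β L ≤ femtoSteps (2 * s) β L + 1 := by
  unfold femtoSteps
  have hu : 0 ≤ s * (L : ℝ) / luscherLambda β L := by positivity
  have h1 : (⌈s * (L : ℝ) / luscherLambda β L⌉₊ : ℝ) < s * (L : ℝ) / luscherLambda β L + 1 := Nat.ceil_lt_add_one hu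
  have h2 : 2 * s * (L : ℝ) / luscherLambda β L ≤ (⌈2 * s * (L : ℝ) / luscherLambda β L⌉₊ : ℝ) := Nat.le_ceil _
  have e : 2 * s * (L : ℝ) / luscherLambda β L = 2 * (s * (L : ℝ) / luscherLambda β L) := by ring
  have h3 : (2 : ℝ) * (⌈s * (L : ℝ) / luscherLambda β L⌉₊ : ℝ) < (⌈2 * s * (L : ℝ) / luscherLambda β L⌉₊ : ℝ) + 2 := by linarith
  have h4 : 2 * ⌈s * (L : ℝ) / luscherLambda β L⌉₊ < ⌈2 * s * (L : ℝ) / luscherLambda β L⌉₊ + 2 := by exact_mod_cast h3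
  omega

/-- The pure-real ratio rule: `|b/a² − b₁/a₁²| ≤ |b − b₁| + 2|a − a₁|` for `a, a₁ ≥ 1`, `0 ≤ b₁ ≤ a₁`. -/
theorem ratio_rule {a a₁ b b₁ : ℝ} (ha : 1 ≤ a) (ha₁ : 1 ≤ a₁) (hb₁ : 0 ≤ b₁) (hb₁a : b₁ ≤ a₁) :
    |b / a ^ 2 - b₁ / a₁ ^ 2| ≤ |b - b₁| + 2 * |a - a₁| := by
  have ha0 : 0 < a := by linarith
  have ha₁0 : 0 < a₁ := by linarith
  have ha2 : (1 : ℝ) ≤ a ^ 2 := by nlinarith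
  set w : ℝ := b₁ * (a₁ + a) / (a ^ 2 * a₁ ^ 2) with hwdef
  have e : b / a ^ 2 - b₁ / a₁ ^ 2 = (b - b₁) / a ^ 2 + (a₁ - a) * w := by
    rw [hwdef]; field_simp [ha0.ne', ha₁0.ne']; ring
  rw [e]
  have h1 : |(b - b₁) / a ^ 2| ≤ |b - b₁| := by
    rw [abs_div, abs_of_pos (by positivity : (0 : ℝ) < a ^ 2)]
    exact div_le_self (abs_nonneg _) ha2
  have hw0 : 0 ≤ w := by rw [hwdef]; positivity
  have hw2 : w ≤ 2 := by
    rw [hwdef, div_le_iff₀ (by positivity)]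
    have h3 : b₁ * (a₁ + a) ≤ a₁ * (a₁ + a) := mul_le_mul_of_nonneg_right hb₁a (by positivity)
    have h4 : a₁ ^ 2 ≤ a ^ 2 * a₁ ^ 2 := le_mul_of_one_le_left (sq_nonneg _) ha2
    have hp : 1 ≤ a * a₁ := by nlinarith
    have h5 : a₁ * a ≤ a ^ 2 * a₁ ^ 2 :=
      calc a₁ * a = 1 * (a * a₁) := by ring
        _ ≤ (a * a₁) * (a * a₁) := mul_le_mul_of_nonneg_right hp (by positivity)
        _ = a ^ 2 * a₁ ^ 2 := by ring
    nlinarith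
  have h2 : |(a₁ - a) * w| ≤ 2 * |a - a₁| := by
    rw [abs_mul, abs_of_nonneg hw0, abs_sub_comm]
    calc |a - a₁| * w ≤ |a - a₁| * 2 := mul_le_mul_of_nonneg_left hw2 (abs_nonneg _)
      _ = 2 * |a - a₁| := mul_comm _ _
  calc |(b - b₁) / a ^ 2 + (a₁ - a) * w| ≤ |(b - b₁) / a ^ 2| + |(a₁ - a) * w| := abs_add_le _ _
    _ ≤ |b - b₁| + 2 * |a - a₁| := add_le_add h1 h2

/-! ## §4 NEW: the dressed-Ritz LOWER JAW at one `(L, β)` (factored out of the workfile's §2 ∕ §6) -/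

/-- ★ **Lower jaw.**  At one `(L, β)` with `β ≥ 1`, `B = oneSiteCoupling β L ≥ 1`, `λ = luscherLambda β L > 0`: a physical `l2`-orthonormal
`qform`-diagonal family `φ₀ … φ_k` with non-increasing Ritz values, Ritz ratios in two-sided Lüscher position with constant `C ≤ C1` against the one-site
ratios (clause (i) of `DressedRitz` at level `k`) and coarse top capture at precision `η` (clause (iii)) forces, for every `j ≤ k`,
`e^{−(C1·λ+η)·λ/L} · μ_j(B)/μ_0(B) ≤ λ_j/λ_0` — Rayleigh–Ritz ≤ min–max (`KTDoorR3.ritzBasicsR3`) bounds `m_j ≤ λ_j`, the top capture bounds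
`e^{−ηλ/L} λ_0 ≤ m_0` (`levelValue_zero_le_of_forall_rayleigh_le`), and the lower Ritz position `μ_j m_0 ≤ e^{Cλ²/L} m_j μ_0` closes the chain.
(The workfile proves this inline twice; credit ym-cruxidea-19978-1.) [cite: Luscher1983, §3] [cite: ReedSimonIV1978, Thm. XIII.1] -/
theorem lowerJaw {L : ℕ} [NeZero L] {β : ℝ} (hβ : 1 ≤ β) (hB1 : 1 ≤ oneSiteCoupling β L) (hlpos : 0 < luscherLambda β L)
    {k : ℕ} {C C1 η : ℝ} (hCC1 : C ≤ C1) (φ : Fin (k + 1) → (GaugeConfig 3 L SU2 → ℝ))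
    (hφphys : ∀ i, IsPhys (φ i)) (hφon : ∀ i l, l2 (φ i) (φ l) = if i = l then 1 else 0)
    (hφdiag : ∀ i l, i ≠ l → qform su2Rep β (φ i) (φ l) = 0)
    (hφanti : ∀ i l : Fin (k + 1), i ≤ l → qform su2Rep β (φ l) (φ l) ≤ qform su2Rep β (φ i) (φ i))
    (hratio : ∀ j : Fin (k + 1),
      qform su2Rep β (φ j) (φ j) * levelValue su2Rep 1 (oneSiteCoupling β L) 0 ≤
          Real.exp (C * luscherLambda β L ^ 2 / L) * (levelValue su2Rep 1 (oneSiteCoupling β L) j * qform su2Rep β (φ 0) (φ 0)) ∧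
        levelValue su2Rep 1 (oneSiteCoupling β L) j * qform su2Rep β (φ 0) (φ 0) ≤
          Real.exp (C * luscherLambda β L ^ 2 / L) * (qform su2Rep β (φ j) (φ j) * levelValue su2Rep 1 (oneSiteCoupling β L) 0))
    (hcap : ∀ ψ : GaugeConfig 3 L SU2 → ℝ, IsPhys ψ →
      qform su2Rep β ψ ψ ≤ Real.exp (η * luscherLambda β L / L) * qform su2Rep β (φ 0) (φ 0) * l2 ψ ψ) :
    ∀ j : ℕ, j ≤ k →
      Real.exp (-((C1 * luscherLambda β L + η) * (luscherLambda β L / L))) * xval 1 (oneSiteCoupling β L) j ≤ xval L β j := by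
  -- scales
  set l : ℝ := luscherLambda β L with hldef
  have hLpos : (0 : ℝ) < L := Nat.cast_pos.mpr (NeZero.pos L)
  set x : ℝ := l / L with hxdef
  have hxpos : 0 < x := div_pos hlpos hLpos
  have hlx : 0 < l * x := mul_pos hlpos hxpos
  set B : ℝ := oneSiteCoupling β L with hBdef
  have hmu0 : 0 < levelValue su2Rep 1 B 0 := levelValue_zero_su2Rep_pos 1 B
  have hl0 : 0 < levelValue su2Rep L β 0 := levelValue_zero_su2Rep_pos L β
  have hmunn : ∀ i : ℕ, 0 ≤ levelValue su2Rep 1 B i := fun i => transferValuesNonneg 1 B i hB1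
  -- the dressed Ritz family: Rayleigh–Ritz, top capture
  have hritzle := KTDoorR3.ritzBasicsR3 L β (k + 1) φ hβ hφphys hφon hφdiag hφanti
  have hmnn : ∀ i, 0 ≤ qform su2Rep β (φ i) (φ i) := fun i => ritz_nonneg hβ (hφphys i)
  set m0 : ℝ := qform su2Rep β (φ 0) (φ 0) with hm0def
  have hm0nn : 0 ≤ m0 := hmnn 0
  have e_eta : η * l / (L : ℝ) = η * x := by rw [hxdef]; ring
  have hcap' : levelValue su2Rep L β 0 ≤ Real.exp (η * x) * m0 := by
    refine levelValue_zero_le_of_forall_rayleigh_le su2Rep β (mul_nonneg (Real.exp_pos _).le hm0nn) fun ψ hψ _ => ?_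
    have h1 := hcap ψ hψ
    rw [e_eta] at h1
    exact h1
  have hcap'' : Real.exp (-(η * x)) * levelValue su2Rep L β 0 ≤ m0 := by
    rw [Real.exp_neg, inv_mul_le_iff₀ (Real.exp_pos _)]; exact hcap'
  set ρ : ℝ := Real.exp (-((C1 * l + η) * x)) with hρdef
  have e_lx : C * l ^ 2 / (L : ℝ) = C * (l * x) := by rw [hxdef]; ring
  have hexpC : Real.exp (C * l ^ 2 / L) ≤ Real.exp (C1 * (l * x)) := by
    rw [e_lx]; exact Real.exp_le_exp.mpr (mul_le_mul_of_nonneg_right hCC1 hlx.le)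
  intro j hj
  have hjlt : j < k + 1 := Nat.lt_succ_of_le hj
  obtain ⟨-, hb⟩ := hratio ⟨j, hjlt⟩
  have hmj : qform su2Rep β (φ ⟨j, hjlt⟩) (φ ⟨j, hjlt⟩) ≤ levelValue su2Rep L β j := hritzle ⟨j, hjlt⟩
  have hb' : levelValue su2Rep 1 B j * m0 ≤
      Real.exp (C * l ^ 2 / L) * (qform su2Rep β (φ ⟨j, hjlt⟩) (φ ⟨j, hjlt⟩) * levelValue su2Rep 1 B 0) := hb
  have h1 : levelValue su2Rep 1 B j * m0 ≤ Real.exp (C1 * (l * x)) * (levelValue su2Rep L β j * levelValue su2Rep 1 B 0) :=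
    calc levelValue su2Rep 1 B j * m0
        ≤ Real.exp (C * l ^ 2 / L) * (qform su2Rep β (φ ⟨j, hjlt⟩) (φ ⟨j, hjlt⟩) * levelValue su2Rep 1 B 0) := hb'
      _ ≤ Real.exp (C1 * (l * x)) * (qform su2Rep β (φ ⟨j, hjlt⟩) (φ ⟨j, hjlt⟩) * levelValue su2Rep 1 B 0) :=
          mul_le_mul_of_nonneg_right hexpC (mul_nonneg (hmnn _) hmu0.le)
      _ ≤ Real.exp (C1 * (l * x)) * (levelValue su2Rep L β j * levelValue su2Rep 1 B 0) :=
          mul_le_mul_of_nonneg_left (mul_le_mul_of_nonneg_right hmj hmu0.le) (Real.exp_pos _).le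
  have key : ρ * levelValue su2Rep 1 B j * levelValue su2Rep L β 0 ≤ levelValue su2Rep L β j * levelValue su2Rep 1 B 0 := by
    have eρ : ρ = Real.exp (-(C1 * (l * x))) * Real.exp (-(η * x)) := by
      rw [hρdef, ← Real.exp_add]; congr 1; ring
    calc ρ * levelValue su2Rep 1 B j * levelValue su2Rep L β 0
        = Real.exp (-(C1 * (l * x))) * (levelValue su2Rep 1 B j * (Real.exp (-(η * x)) * levelValue su2Rep L β 0)) := by
          rw [eρ]; ring
      _ ≤ Real.exp (-(C1 * (l * x))) * (levelValue su2Rep 1 B j * m0) :=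
          mul_le_mul_of_nonneg_left (mul_le_mul_of_nonneg_left hcap'' (hmunn j)) (Real.exp_pos _).le
      _ ≤ Real.exp (-(C1 * (l * x))) * (Real.exp (C1 * (l * x)) * (levelValue su2Rep L β j * levelValue su2Rep 1 B 0)) :=
          mul_le_mul_of_nonneg_left h1 (Real.exp_pos _).le
      _ = levelValue su2Rep L β j * levelValue su2Rep 1 B 0 := by
          rw [← mul_assoc, ← Real.exp_add, neg_add_cancel, Real.exp_zero, one_mul]
  show ρ * (levelValue su2Rep 1 B j / levelValue su2Rep 1 B 0) ≤ levelValue su2Rep L β j / levelValue su2Rep L β 0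
  rw [← mul_div_assoc, div_le_div_iff₀ hmu0 hl0]
  exact key

end Summit.QuantumFields.YangMills.Theorems.FemtoTransferGap.UTD

end
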